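import Mathlib
import HarnessLib
import Literature.Analysis.FluidPDE.SelfSimilar
import Literature.Analysis.FluidPDE.TypeIAncientMild
import Summits.NavierStokesRegularity.NavierStokesRegularity.Theorems.QuarterLogPincerThinCascadeDefs
import Summits.NavierStokesRegularity.NavierStokesRegularity.Theorems.QuarterLogPincerTruncationEdgeAnatomyDefs

/-!
# Crux `QuarterLogPincer.TypeIQuantSubcubicExp` (stmt-NavierStokesRegularity-24077), EDGE line `truncation_edge` (ns-idea-7 g8/g9):
# **P3 = P3a ∘ P3b BY NAME** — `stubSupShadowing_of_parts : StubSupShadowingCore → StubSupShadowingLocal → StubSupShadowing`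

Tree copy of the AUTHOR'S GLUE (ns-idea-7 g9, workfile `Cruxes/TypeIQuantSubcubicExp/Lines/truncation_edge.lean` v1.5: `supShadowing_of_core_of_local`,
`stubSupShadowing_of_parts`, VERBATIM), re-homed by the pub-ns-dss typer (g35; `--supports stmt-NavierStokesRegularity-24077`, helper) over
`…TruncationEdgeAnatomyDefs` (p669402): the polynomial-loss core P3a makes the frame solution globally `δ'`-close for `ρ ≥ Kε^{−κ}`, and the
localisation piece P3b then supplies the outer profile and the log-shaped `L³` budget.  With `…SupShadowingCore` (P3a, p670348) and
`…ProfileIntegration` (P3b′ ⇒ P3b) this leaves P3 = P3b′.  Credit: ns-idea-7 g9.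

HONEST FRAME: glue about hypothetical objects; P3b′, T1, 24077, 22144, W7 and NS regularity OPEN / not proved.
-/

noncomputable section

-- the summit-side namespace repeats a component by design (D-0017)
set_option linter.dupNamespace false

namespace Summit.NavierStokesRegularity.NavierStokesRegularity.Cruxes.TypeIQuantSubcubicExp.TruncationEdge

open MeasureTheory Set Function Metric Filter Topology
open scoped ENNReal NNReal
open Literature.Analysis Literature.Analysis.FluidPDE
open Summit.NavierStokesRegularity.NavierStokesRegularity.Cruxes.TypeIQuantSubcubicExp.ThinCascade

/-! ### P3 = P3a ∘ P3b (author's v1.5 glue, verbatim) -/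

/-- **P3 = P3a ∘ P3b** (kernel-checked glue): the polynomial-loss core makes the frame solution
globally `δ'`-close for `ρ ≥ Kε^{−κ}`, and the localisation piece then supplies the outer profile and
the log-shaped `L³` budget. [this file; line object] -/
theorem supShadowing_of_core_of_local {v : ℝ → EuclideanSpace ℝ (Fin 3) → EuclideanSpace ℝ (Fin 3)}
    (hc : SupShadowingCore v) (hl : SupShadowingLocal v) : SupShadowing v := by
  intro K₀ δ hK₀ hδ hδ1
  obtain ⟨κ, Ka, hκ, hKa, hcore⟩ := hc K₀ hK₀
  obtain ⟨δ₀, ρ₁, Kb, hδ₀, hδ₀1, hρ₁, hKb, hloc⟩ := hl K₀ hK₀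
  set δ' : ℝ := min δ δ₀ with hδ'_def
  have hδ'pos : 0 < δ' := lt_min hδ hδ₀
  have hδ'δ : δ' ≤ δ := min_le_left _ _
  have hδ'δ₀ : δ' ≤ δ₀ := min_le_right _ _
  set K : ℝ := max (max 1 ρ₁) (max (max (Ka / δ') (K₀ / δ')) Kb) with hK_def
  have hK1 : 1 ≤ K := (le_max_left 1 ρ₁).trans (le_max_left _ _)
  have hKρ₁ : ρ₁ ≤ K := (le_max_right 1 ρ₁).trans (le_max_left _ _)
  have hKa' : Ka / δ' ≤ K :=
    ((le_max_left (Ka / δ') (K₀ / δ')).trans (le_max_left _ Kb)).trans (le_max_right _ _)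
  have hK₀' : K₀ / δ' ≤ K :=
    ((le_max_right (Ka / δ') (K₀ / δ')).trans (le_max_left _ Kb)).trans (le_max_right _ _)
  have hKb' : Kb ≤ K := (le_max_right (max (Ka / δ') (K₀ / δ')) Kb).trans (le_max_right _ _)
  refine ⟨κ, K, hκ, hK1, ?_⟩
  intro ε hε ρ hρ u₀ hu₀ T' hT' u p hfr hu0 hboot
  have hεκ : 1 ≤ ε ^ (-κ) :=
    Real.one_le_rpow_of_pos_of_le_one_of_nonpos hε.1 (by linarith [hε.2]) (by linarith)
  have hK0 : 0 ≤ K := by linarith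
  have hKρ : K ≤ ρ := (le_mul_of_one_le_right hK0 hεκ).trans hρ
  have hρ1 : 1 ≤ ρ := hK1.trans hKρ
  have hρpos : 0 < ρ := by linarith
  have hρρ₁ : ρ₁ ≤ ρ := hKρ₁.trans hKρ
  -- the core: global smallness `≤ δ'`
  have hboot2 : ∀ t ∈ Set.Icc 0 T', ∀ x, ‖u t x - v (t - 1) x‖ ≤ 2 := fun t ht x =>
    (hboot t ht x).trans (by linarith)
  have hthr : Ka * ε ^ (-κ) ≤ δ' * ρ := by
    have h1 : Ka / δ' * ε ^ (-κ) ≤ ρ :=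
      (mul_le_mul_of_nonneg_right hKa' (by linarith)).trans hρ
    have h2 : Ka * ε ^ (-κ) = δ' * (Ka / δ' * ε ^ (-κ)) := by
      field_simp
    rw [h2]
    exact mul_le_mul_of_nonneg_left h1 hδ'pos.le
  have hsmall : ∀ t ∈ Set.Icc 0 T', ∀ x, ‖u t x - v (t - 1) x‖ ≤ δ' := by
    intro t ht x
    have h := hcore ε hε ρ hρ1 u₀ hu₀ T' hT' u p hfr hu0 hboot2 t ht x
    have : Ka / ρ * ε ^ (-κ) ≤ δ' := by
      rw [div_mul_eq_mul_div, div_le_iff₀ hρpos]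
      exact hthr
    exact h.trans this
  have hdat : K₀ / ρ ≤ δ' := by
    rw [div_le_iff₀ hρpos]
    have h1 : K₀ / δ' ≤ ρ := hK₀'.trans hKρ
    rw [div_le_iff₀ hδ'pos] at h1
    linarith [mul_comm δ' ρ]
  have hT'1 : T' ∈ Set.Ioo (0 : ℝ) 1 := ⟨hT'.1, by linarith [hT'.2, hε.1]⟩
  obtain ⟨hout, k, hk0, hk3, hkb⟩ :=
    hloc δ' hδ'pos hδ'δ₀ ρ hρρ₁ hdat u₀ hu₀ T' hT'1 u p hfr hu0 hsmall
  have hlog : 0 ≤ 1 + Real.log ρ := by linarith [Real.log_nonneg hρ1]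
  refine ⟨fun t ht x => (hsmall t ht x).trans hδ'δ, fun t ht x hx => (hout t ht x hx).trans ?_,
    k, hk0, hk3.trans (mul_le_mul_of_nonneg_right hKb' hlog), hkb⟩
  exact div_le_div_of_nonneg_right hKb' hρpos.le

/-- The registered closed form of (P3) from those of (P3a) — PROVED above — and (P3b). -/
theorem stubSupShadowing_of_parts (ha : StubSupShadowingCore) (hb : StubSupShadowingLocal) :
    StubSupShadowing := fun M A v hv hdec =>
  supShadowing_of_core_of_local (ha M v hv) (hb M A v hv hdec)

end Summit.NavierStokesRegularity.NavierStokesRegularity.Cruxes.TypeIQuantSubcubicExp.TruncationEdge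

end
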